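import Mathlib

/-!
# Tier7/Line1/SepCurve — the «curve algebra» `R ⊕ V ⊕ R·t ⊕ J`

Infrastructure for the SEPARATING DATUM of t7-L1-p2 (LINE L1, residual probe). The cohomology ring of a curve is
`ℂ ⊕ H¹ ⊕ ℂ·[pt]` with `H¹ · H¹ → ℂ·[pt]` through the intersection form; over a base ring `R` (here: another curve
algebra, which makes `Curve R V J β` the cohomology ring of a product of two curves) we take
`Curve R V J β := R ⊕ V ⊕ R ⊕ J` with multiplication
`(c, v, t, j) * (c', v', t', j') = (c c', c • v' + c' • v, c t' + c' t + β v v', c • j' + c' • j)`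
for an `R`-bilinear `β : V →ₗ[R] V →ₗ[R] R`; `J` is a square-zero junk summand (it only serves the injectivity of
the Albanese pull-back `alb` in the datum). `Curve` is an associative ring (commutative when `β` is symmetric) and a
`ℂ`-algebra when `R` is; a compatible triple `(σ, τ, κ)` of a `ℂ`-algebra automorphism of `R` and `σ`-semilinear
automorphisms of `V`, `J` induces a `ℂ`-algebra automorphism `AutData.toAlgEquiv` (the Hecke translates); compatible
antilinear involutions induce the antilinear ring involution `BarData.bar` (complex conjugation).
`import Mathlib` only. Author: t7-L1-p2 (prover-pub-hodge-repro2-t7-L1-p2-g0-0). §8(d): NO.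
-/

namespace Summit.Ventures.HodgeRepro2.Tier7.Line1.Sep

noncomputable section

section RingPart

variable (R : Type*) [CommRing R] (V : Type*) [AddCommGroup V] [Module R V]
  (J : Type*) [AddCommGroup J]

/-- the curve algebra `R ⊕ V ⊕ R·t ⊕ J` (see the module docstring) -/
@[ext]
structure Curve (β : V →ₗ[R] V →ₗ[R] R) where
  /-- the degree-`0` component -/
  c : R
  /-- the degree-`1` component -/
  v : V
  /-- the coefficient of the top class `t` -/
  t : R
  /-- the square-zero junk component -/
  j : J

namespace Curve

variable {R V J} {β : V →ₗ[R] V →ₗ[R] R}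

/-- the zero element -/
instance : Zero (Curve R V J β) := ⟨⟨0, 0, 0, 0⟩⟩
/-- componentwise addition -/
instance : Add (Curve R V J β) := ⟨fun x y => ⟨x.c + y.c, x.v + y.v, x.t + y.t, x.j + y.j⟩⟩
/-- componentwise negation -/
instance : Neg (Curve R V J β) := ⟨fun x => ⟨-x.c, -x.v, -x.t, -x.j⟩⟩
/-- the unit `(1, 0, 0, 0)` -/
instance : One (Curve R V J β) := ⟨⟨1, 0, 0, 0⟩⟩

/-- the `c`-component of `0` -/
@[simp] theorem zero_c : (0 : Curve R V J β).c = 0 := rfl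
/-- the `v`-component of `0` -/
@[simp] theorem zero_v : (0 : Curve R V J β).v = 0 := rfl
/-- the `t`-component of `0` -/
@[simp] theorem zero_t : (0 : Curve R V J β).t = 0 := rfl
/-- the `j`-component of `0` -/
@[simp] theorem zero_j : (0 : Curve R V J β).j = 0 := rfl
/-- the `c`-component of a sum -/
@[simp] theorem add_c (x y : Curve R V J β) : (x + y).c = x.c + y.c := rfl
/-- the `v`-component of a sum -/
@[simp] theorem add_v (x y : Curve R V J β) : (x + y).v = x.v + y.v := rfl
/-- the `t`-component of a sum -/
@[simp] theorem add_t (x y : Curve R V J β) : (x + y).t = x.t + y.t := rfl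
/-- the `j`-component of a sum -/
@[simp] theorem add_j (x y : Curve R V J β) : (x + y).j = x.j + y.j := rfl
/-- the `c`-component of a negative -/
@[simp] theorem neg_c (x : Curve R V J β) : (-x).c = -x.c := rfl
/-- the `v`-component of a negative -/
@[simp] theorem neg_v (x : Curve R V J β) : (-x).v = -x.v := rfl
/-- the `t`-component of a negative -/
@[simp] theorem neg_t (x : Curve R V J β) : (-x).t = -x.t := rfl
/-- the `j`-component of a negative -/
@[simp] theorem neg_j (x : Curve R V J β) : (-x).j = -x.j := rfl
/-- the `c`-component of `1` -/
@[simp] theorem one_c : (1 : Curve R V J β).c = 1 := rfl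
/-- the `v`-component of `1` -/
@[simp] theorem one_v : (1 : Curve R V J β).v = 0 := rfl
/-- the `t`-component of `1` -/
@[simp] theorem one_t : (1 : Curve R V J β).t = 0 := rfl
/-- the `j`-component of `1` -/
@[simp] theorem one_j : (1 : Curve R V J β).j = 0 := rfl
/-- the additive group structure (componentwise) -/
instance : AddCommGroup (Curve R V J β) where
  add_assoc := by intros; ext <;> simp [add_assoc]
  zero_add := by intros; ext <;> simp
  add_zero := by intros; ext <;> simp
  nsmul := nsmulRec
  zsmul := zsmulRec
  neg_add_cancel := by intros; ext <;> simp
  add_comm := by intros; ext <;> simp [add_comm]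

/-- the `c`-component of a difference -/
@[simp] theorem sub_c (x y : Curve R V J β) : (x - y).c = x.c - y.c := by
  rw [sub_eq_add_neg, add_c, neg_c, sub_eq_add_neg]
/-- the `v`-component of a difference -/
@[simp] theorem sub_v (x y : Curve R V J β) : (x - y).v = x.v - y.v := by
  rw [sub_eq_add_neg, add_v, neg_v, sub_eq_add_neg]
/-- the `t`-component of a difference -/
@[simp] theorem sub_t (x y : Curve R V J β) : (x - y).t = x.t - y.t := by
  rw [sub_eq_add_neg, add_t, neg_t, sub_eq_add_neg]
/-- the `j`-component of a difference -/
@[simp] theorem sub_j (x y : Curve R V J β) : (x - y).j = x.j - y.j := by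
  rw [sub_eq_add_neg, add_j, neg_j, sub_eq_add_neg]

section Mul

variable [Module R J]

/-- the multiplication of the module docstring -/
instance : Mul (Curve R V J β) :=
  ⟨fun x y => ⟨x.c * y.c, x.c • y.v + y.c • x.v, x.c * y.t + y.c * x.t + β x.v y.v, x.c • y.j + y.c • x.j⟩⟩

/-- the `c`-component of a product -/
@[simp] theorem mul_c (x y : Curve R V J β) : (x * y).c = x.c * y.c := rfl
/-- the `v`-component of a product -/
@[simp] theorem mul_v (x y : Curve R V J β) : (x * y).v = x.c • y.v + y.c • x.v := rfl
/-- the `t`-component of a product -/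
@[simp] theorem mul_t (x y : Curve R V J β) : (x * y).t = x.c * y.t + y.c * x.t + β x.v y.v := rfl
/-- the `j`-component of a product -/
@[simp] theorem mul_j (x y : Curve R V J β) : (x * y).j = x.c • y.j + y.c • x.j := rfl

/-- the ring structure -/
instance : Ring (Curve R V J β) where
  mul_assoc := by
    intro x y z
    ext
    · simp [mul_assoc]
    · simp only [mul_v, mul_c, smul_add, smul_smul]
      rw [mul_comm z.c x.c, mul_comm z.c y.c]
      abel
    · simp only [mul_t, mul_c, mul_v, map_add, map_smul, LinearMap.add_apply, LinearMap.smul_apply,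
        smul_eq_mul]
      ring
    · simp only [mul_j, mul_c, smul_add, smul_smul]
      rw [mul_comm z.c x.c, mul_comm z.c y.c]
      abel
  one_mul := by intro x; ext <;> simp
  mul_one := by intro x; ext <;> simp
  left_distrib := by
    intro x y z; ext
    · simp [mul_add]
    · simp only [mul_v, add_v, add_c, smul_add, add_smul]; abel
    · simp only [mul_t, add_t, add_c, add_v, map_add]; ring
    · simp only [mul_j, add_j, add_c, smul_add, add_smul]; abel
  right_distrib := by
    intro x y z; ext
    · simp [add_mul]
    · simp only [mul_v, add_v, add_c, smul_add, add_smul]; abel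
    · simp only [mul_t, add_t, add_c, add_v, map_add, LinearMap.add_apply]; ring
    · simp only [mul_j, add_j, add_c, smul_add, add_smul]; abel
  zero_mul := by intro x; ext <;> simp
  mul_zero := by intro x; ext <;> simp

/-- commutativity, for a symmetric `β` -/
theorem mul_comm' (hβ : ∀ v w, β v w = β w v) (x y : Curve R V J β) : x * y = y * x := by
  ext
  · simp [mul_comm]
  · simp only [mul_v]; abel
  · simp only [mul_t, hβ x.v y.v]; ring
  · simp only [mul_j]; abel

end Mul

section CModule

variable [Module ℂ R] [Module ℂ V] [Module ℂ J]

/-- componentwise `ℂ`-scalars -/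
instance : SMul ℂ (Curve R V J β) := ⟨fun z x => ⟨z • x.c, z • x.v, z • x.t, z • x.j⟩⟩

/-- the `c`-component of a scalar multiple -/
@[simp] theorem smul_c (z : ℂ) (x : Curve R V J β) : (z • x).c = z • x.c := rfl
/-- the `v`-component of a scalar multiple -/
@[simp] theorem smul_v (z : ℂ) (x : Curve R V J β) : (z • x).v = z • x.v := rfl
/-- the `t`-component of a scalar multiple -/
@[simp] theorem smul_t (z : ℂ) (x : Curve R V J β) : (z • x).t = z • x.t := rfl
/-- the `j`-component of a scalar multiple -/
@[simp] theorem smul_j (z : ℂ) (x : Curve R V J β) : (z • x).j = z • x.j := rfl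

/-- the `ℂ`-module structure (componentwise) -/
instance : Module ℂ (Curve R V J β) where
  one_smul := by intros; ext <;> simp
  mul_smul := by intros; ext <;> simp [mul_smul]
  smul_zero := by intros; ext <;> simp
  smul_add := by intros; ext <;> simp
  add_smul := by intros; ext <;> simp [add_smul]
  zero_smul := by intros; ext <;> simp

/-- the degree-`0` coordinate, `ℂ`-linear -/
def cL : Curve R V J β →ₗ[ℂ] R where
  toFun x := x.c
  map_add' _ _ := rfl
  map_smul' _ _ := rfl

/-- the degree-`1` coordinate, `ℂ`-linear -/
def vL : Curve R V J β →ₗ[ℂ] V where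
  toFun x := x.v
  map_add' _ _ := rfl
  map_smul' _ _ := rfl

/-- the top coordinate, `ℂ`-linear -/
def tL : Curve R V J β →ₗ[ℂ] R where
  toFun x := x.t
  map_add' _ _ := rfl
  map_smul' _ _ := rfl

/-- the junk coordinate, `ℂ`-linear -/
def jL : Curve R V J β →ₗ[ℂ] J where
  toFun x := x.j
  map_add' _ _ := rfl
  map_smul' _ _ := rfl

/-- `cL` unfolded -/
@[simp] theorem cL_apply (x : Curve R V J β) : cL x = x.c := rfl
/-- `vL` unfolded -/
@[simp] theorem vL_apply (x : Curve R V J β) : vL x = x.v := rfl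
/-- `tL` unfolded -/
@[simp] theorem tL_apply (x : Curve R V J β) : tL x = x.t := rfl
/-- `jL` unfolded -/
@[simp] theorem jL_apply (x : Curve R V J β) : jL x = x.j := rfl

/-- the embedding of the degree-`1` part, `ℂ`-linear -/
def ofV : V →ₗ[ℂ] Curve R V J β where
  toFun v := ⟨0, v, 0, 0⟩
  map_add' _ _ := by ext <;> simp
  map_smul' _ _ := by ext <;> simp

/-- the embedding of the junk part, `ℂ`-linear -/
def ofJ : J →ₗ[ℂ] Curve R V J β where
  toFun j := ⟨0, 0, 0, j⟩
  map_add' _ _ := by ext <;> simp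
  map_smul' _ _ := by ext <;> simp

/-- `ofV` unfolded -/
theorem ofV_apply (v : V) : (ofV (J := J) (β := β) v) = ⟨0, v, 0, 0⟩ := rfl
/-- `ofJ` unfolded -/
theorem ofJ_apply (j : J) : (ofJ (V := V) (β := β) j) = ⟨0, 0, 0, j⟩ := rfl

end CModule

end Curve

end RingPart

end

end Summit.Ventures.HodgeRepro2.Tier7.Line1.Sep
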